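import Literature.Topology.FourManifolds.FishtailEndModel
import HarnessLib

/-!
# The fishtail end model with a depth-dependent staircase

A variant of `FishtailEndModel.lean` (R. Gompf, *More Cappell–Shaneson spheres are standard*,
Algebr. Geom. Topol. 10 (2010), Lemma 2.2: the base rotation `(s, t, x) ↦ (s, s + t, x)` of the
collar `I × ∂Φ` of the fishtail neighbourhood, realised as a fibrewise re-gluing of the model
mapping torus `MTorus Ψ`). There the amount of the `γ`-twist at full turn is `2π κ(s)` with the
fixed two-step staircase `κ = fishStair a b` of the base coordinate `s`. When the model end is
embedded into the straightened Cappell–Shaneson model, the shell of the box `N` over its flat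
front face is the radial collar of a plane domain, whose angular coordinate fans out with the
depth; to make the twist at full turn agree **on a whole neighbourhood of the front face** with
Gompf's Dehn twist `δ` of the fibre (a function of the fibre coordinate `y` alone, as required by
the sliver criterion `nonempty_diffeomorph_prodSurgered_of_twistingDiffeo`), the staircase has to
be allowed to depend on the depth coordinate `z₁` as well. Nothing else changes: the turn
`fishTurn g κ c` already takes the real number `κ` as a parameter, and the depth `z₁` is preserved
by every map in sight.

* `Literature.Topology.FourManifolds.FishParamsD` — parameters: the step arc `[a′, b′]` of the
  monodromy lift, a jointly smooth staircase `κ : 𝕊¹ × ℝ → ℝ` with `κ (z₁, s + 1) = κ (z₁, s) + 1`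
  for `0 ≤ s ≤ 1/2` (the monodromy overlap), and the turn profile `u` of the depth;
* `FishParamsD.twistOne`, `FishParamsD.twistTwo`, `FishParamsD.isOpenGluingWith_mTorus_twist`,
  `FishParamsD.baseTurn` with `baseTurn_inl`/`baseTurn_inr`, `baseTurn_inl_of_eq_zero`/`…inr…`
  (identity where `u = 0`) and `baseTurn_inl_of_eq_two_pi`/`…inr…` (the sliver twist
  `z₃ ↦ z₃ e^{2πi κ(z₁, s)}` where `u = 2π`), exactly as in `FishtailEndModel.lean`.

Everything is proved; no named facts are introduced.

## References

* R. E. Gompf, *More Cappell–Shaneson spheres are standard*, Algebr. Geom. Topol. 10 (2010)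
  1665–1681: Lemma 2.2 and its proof; proof of Thm 2.1, last paragraph. [GompfAGT2010]
-/

open scoped Manifold ContDiff Topology Real
open Set Function Metric Complex

noncomputable section

namespace Literature.Topology.FourManifolds

/-- Local notation: the model with corners `𝓣 = (𝓡 1).prod ((𝓡 1).prod (𝓡 1))` of `ThreeTorus`. -/
local notation "𝓣" =>
  (ModelWithCorners.prod (𝓡 1) (ModelWithCorners.prod (𝓡 1) (𝓡 1)))

/-- **Parameters of the fishtail end model with a depth-dependent staircase**: the arc `[a′, b′]`
of the step of the monodromy lift (`0 < a′ < b′ < π`), a jointly smooth staircase `κ (z₁, s)`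
gaining one unit per turn on the monodromy overlap, and the smooth turn profile `u` of the depth
coordinate `z₁`. [folklore] -/
structure FishParamsD where
  /-- Start of the step of the monodromy lift. -/
  a' : ℝ
  /-- End of the step of the monodromy lift. -/
  b' : ℝ
  ha' : 0 < a'
  hab' : a' < b'
  hb' : b' < π
  /-- The staircase, a function of the depth `z₁` and the base coordinate `s`. -/
  κ : Circle → ℝ → ℝ
  hκ : ContMDiff ((𝓡 1).prod 𝓘(ℝ, ℝ)) 𝓘(ℝ, ℝ) ∞ fun p : Circle × ℝ ↦ κ p.1 p.2
  κ_add_one : ∀ z s, 0 ≤ s → s ≤ 1 / 2 → κ z (s + 1) = κ z s + 1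
  /-- The turn profile of the depth. -/
  u : Circle → ℝ
  hu : ContMDiff (𝓡 1) 𝓘(ℝ, ℝ) ∞ u

namespace FishParamsD

variable (D : FishParamsD)

/-- The monodromy lift `g = gompfLift a′ b′`. [folklore] -/
abbrev lift : ℝ → ℝ := gompfLift D.a' D.b'

/-- The lift is smooth. [folklore] -/
theorem contDiff_lift : ContDiff ℝ ∞ D.lift := contDiff_gompfLift D.ha' D.hab' D.hb'

/-- The lift has degree one. [folklore] -/
theorem lift_add_two_pi (θ : ℝ) : D.lift (θ + 2 * π) = D.lift θ + 2 * π := gompfLift_add_two_pi _ _ θ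

/-- The monodromy `Ψ` of the model. [folklore] -/
abbrev monodromy : ThreeTorus ≃ₘ⟮𝓣, 𝓣⟯ ThreeTorus := fishMonodromy D.ha' D.hab' D.hb'

/-- Joint smoothness of `(s, z) ↦ F_{κ(z₁, s), t u(z₁)} z` in the base coordinate `s` and the
fibre point `z` (`t = ±1`). [folklore] -/
theorem contMDiff_fishTurn_family (t : ℝ) :
    ContMDiff (𝓘(ℝ, ℝ).prod 𝓣) 𝓣 ∞
      fun q : ℝ × ThreeTorus ↦ fishTurn D.lift (D.κ q.2.1 q.1) (t * D.u q.2.1) q.2 := by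
  have h1 : ContMDiff (𝓘(ℝ, ℝ).prod 𝓣) (𝓡 1) ∞ fun q : ℝ × ThreeTorus ↦ q.2.1 :=
    contMDiff_fst.comp contMDiff_snd
  have hs : ContMDiff (𝓘(ℝ, ℝ).prod 𝓣) 𝓘(ℝ, ℝ) ∞ fun q : ℝ × ThreeTorus ↦ D.κ q.2.1 q.1 :=
    D.hκ.comp (h1.prodMk contMDiff_fst)
  have hc : ContMDiff (𝓘(ℝ, ℝ).prod 𝓣) 𝓘(ℝ, ℝ) ∞ fun q : ℝ × ThreeTorus ↦ t * D.u q.2.1 :=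
    contMDiff_const.mul (D.hu.comp h1)
  have h2 : ContMDiff (𝓘(ℝ, ℝ).prod 𝓣) (𝓡 1) ∞ fun q : ℝ × ThreeTorus ↦ q.2.2.1 :=
    contMDiff_fst.comp (contMDiff_snd.comp contMDiff_snd)
  have h3 : ContMDiff (𝓘(ℝ, ℝ).prod 𝓣) (𝓡 1) ∞ fun q : ℝ × ThreeTorus ↦ q.2.2.2 :=
    contMDiff_snd.comp (contMDiff_snd.comp contMDiff_snd)
  have hexp : ContMDiff (𝓘(ℝ, ℝ).prod 𝓣) (𝓡 1) ∞ fun q : ℝ × ThreeTorus ↦ Circle.exp (t * D.u q.2.1) :=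
    contMDiff_circleExp.comp hc
  have hL := contMDiff_circleMapOfLift_param (P := ℝ × ℝ)
    (Φ := fun p θ ↦ turnLift D.lift p.1 p.2 θ) (k := 0) (contDiff_turnLift_uncurry D.contDiff_lift)
    (fun p θ ↦ turnLift_periodic D.lift_add_two_pi p.1 p.2 θ)
  have hpar : ContMDiff (𝓘(ℝ, ℝ).prod 𝓣) (𝓘(ℝ, ℝ × ℝ).prod (𝓡 1)) ∞
      fun q : ℝ × ThreeTorus ↦ ((D.κ q.2.1 q.1, t * D.u q.2.1), q.2.2.1) :=
    (hs.prodMk_space hc).prodMk h2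
  have hshear : ContMDiff (𝓘(ℝ, ℝ).prod 𝓣) (𝓡 1) ∞ fun q : ℝ × ThreeTorus ↦
      circleMapOfLift (turnLift D.lift (D.κ q.2.1 q.1) (t * D.u q.2.1)) q.2.2.1 :=
    hL.comp hpar
  exact (contMDiff_fst.comp contMDiff_snd).prodMk ((h2.mul hexp).prodMk (h3.mul hshear))

/-- **The re-gluing diffeomorphism of the first cylinder** `T³ × (0, 1)`:
`(x, s) ↦ (F_{κ(x₁, s), u(x₁)} x, s)`. [folklore] -/
def twistOne : (ThreeTorus × ↥mappingTorusPieceOne) ≃ₘ⟮ModelWithCorners.prod 𝓣 𝓘(ℝ, ℝ),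
    ModelWithCorners.prod 𝓣 𝓘(ℝ, ℝ)⟯ (ThreeTorus × ↥mappingTorusPieceOne) where
  toFun p := (fishTurn D.lift (D.κ p.1.1 p.2) (D.u p.1.1) p.1, p.2)
  invFun p := (fishTurn D.lift (D.κ p.1.1 p.2) (-D.u p.1.1) p.1, p.2)
  left_inv p := by
    show (fishTurn D.lift (D.κ (fishTurn D.lift (D.κ p.1.1 p.2) (D.u p.1.1) p.1).1 p.2)
      (-D.u (fishTurn D.lift (D.κ p.1.1 p.2) (D.u p.1.1) p.1).1)
      (fishTurn D.lift (D.κ p.1.1 p.2) (D.u p.1.1) p.1), p.2) = p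
    rw [fishTurn_fst, fishTurn_neg_fishTurn D.lift_add_two_pi]
  right_inv p := by
    show (fishTurn D.lift (D.κ (fishTurn D.lift (D.κ p.1.1 p.2) (-D.u p.1.1) p.1).1 p.2)
      (D.u (fishTurn D.lift (D.κ p.1.1 p.2) (-D.u p.1.1) p.1).1)
      (fishTurn D.lift (D.κ p.1.1 p.2) (-D.u p.1.1) p.1), p.2) = p
    rw [fishTurn_fst, fishTurn_fishTurn_neg D.lift_add_two_pi]
  contMDiff_toFun := by
    refine ContMDiff.prodMk ?_ contMDiff_snd
    have h := D.contMDiff_fishTurn_family 1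
    simp only [one_mul] at h
    exact h.comp ((contMDiff_subtype_val.comp contMDiff_snd).prodMk contMDiff_fst)
  contMDiff_invFun := by
    refine ContMDiff.prodMk ?_ contMDiff_snd
    have h := D.contMDiff_fishTurn_family (-1)
    simp only [neg_mul, one_mul] at h
    exact h.comp ((contMDiff_subtype_val.comp contMDiff_snd).prodMk contMDiff_fst)

/-- The first re-gluing diffeomorphism as a function. [folklore] -/
@[simp] theorem twistOne_apply (p : ThreeTorus × ↥mappingTorusPieceOne) :
    D.twistOne p = (fishTurn D.lift (D.κ p.1.1 p.2) (D.u p.1.1) p.1, p.2) := rfl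

/-- **The re-gluing diffeomorphism of the second cylinder** `T³ × (1/2, 3/2)`:
`(y, t) ↦ (F_{κ(y₁, t), u(y₁)} y, t)`. [folklore] -/
def twistTwo : (ThreeTorus × ↥mappingTorusPieceTwo) ≃ₘ⟮ModelWithCorners.prod 𝓣 𝓘(ℝ, ℝ),
    ModelWithCorners.prod 𝓣 𝓘(ℝ, ℝ)⟯ (ThreeTorus × ↥mappingTorusPieceTwo) where
  toFun p := (fishTurn D.lift (D.κ p.1.1 p.2) (D.u p.1.1) p.1, p.2)
  invFun p := (fishTurn D.lift (D.κ p.1.1 p.2) (-D.u p.1.1) p.1, p.2)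
  left_inv p := by
    show (fishTurn D.lift (D.κ (fishTurn D.lift (D.κ p.1.1 p.2) (D.u p.1.1) p.1).1 p.2)
      (-D.u (fishTurn D.lift (D.κ p.1.1 p.2) (D.u p.1.1) p.1).1)
      (fishTurn D.lift (D.κ p.1.1 p.2) (D.u p.1.1) p.1), p.2) = p
    rw [fishTurn_fst, fishTurn_neg_fishTurn D.lift_add_two_pi]
  right_inv p := by
    show (fishTurn D.lift (D.κ (fishTurn D.lift (D.κ p.1.1 p.2) (-D.u p.1.1) p.1).1 p.2)
      (D.u (fishTurn D.lift (D.κ p.1.1 p.2) (-D.u p.1.1) p.1).1)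
      (fishTurn D.lift (D.κ p.1.1 p.2) (-D.u p.1.1) p.1), p.2) = p
    rw [fishTurn_fst, fishTurn_fishTurn_neg D.lift_add_two_pi]
  contMDiff_toFun := by
    refine ContMDiff.prodMk ?_ contMDiff_snd
    have h := D.contMDiff_fishTurn_family 1
    simp only [one_mul] at h
    exact h.comp ((contMDiff_subtype_val.comp contMDiff_snd).prodMk contMDiff_fst)
  contMDiff_invFun := by
    refine ContMDiff.prodMk ?_ contMDiff_snd
    have h := D.contMDiff_fishTurn_family (-1)
    simp only [neg_mul, one_mul] at h
    exact h.comp ((contMDiff_subtype_val.comp contMDiff_snd).prodMk contMDiff_fst)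

/-- The second re-gluing diffeomorphism as a function. [folklore] -/
@[simp] theorem twistTwo_apply (p : ThreeTorus × ↥mappingTorusPieceTwo) :
    D.twistTwo p = (fishTurn D.lift (D.κ p.1.1 p.2) (D.u p.1.1) p.1, p.2) := rfl

/-- **The re-gluing diffeomorphisms respect the mapping torus relation** (identically on the
overlap `t = s`; on the monodromy overlap `t = s + 1` because `κ (z₁, s + 1) = κ (z₁, s) + 1`,
`F_{κ+1} ∘ Ψ = Ψ ∘ F_κ` and `Ψ` preserves the depth `z₁`). [cite: GompfAGT2010, Lemma 2.2 (proof: the diffeomorphism (s,t,x) ↦ (s,s+t,x) is well defined on the collar of ∂Φ)] -/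
theorem mappingTorusRel_twist_iff (p : ThreeTorus × ↥mappingTorusPieceOne)
    (q : ThreeTorus × ↥mappingTorusPieceTwo) :
    mappingTorusRel D.monodromy (D.twistOne p) (D.twistTwo q) ↔ mappingTorusRel D.monodromy p q := by
  have hg1 := D.lift_add_two_pi
  obtain ⟨x, s⟩ := p
  obtain ⟨y, t⟩ := q
  simp only [mappingTorusRel, twistOne_apply, twistTwo_apply]
  refine or_congr ⟨fun ⟨h1, h2⟩ ↦ ⟨h1, ?_⟩, fun ⟨h1, h2⟩ ↦ ⟨h1, ?_⟩⟩
    ⟨fun ⟨h1, h2⟩ ↦ ⟨h1, ?_⟩, fun ⟨h1, h2⟩ ↦ ⟨h1, ?_⟩⟩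
  · have hd : y.1 = x.1 := by simpa using congrArg Prod.fst h2
    rw [h1, hd] at h2
    exact fishTurn_injective hg1 _ _ h2
  · rw [h1, h2]
  · have hs0 : 0 ≤ (s : ℝ) := s.2.1.le
    have hs : (s : ℝ) ≤ 1 / 2 := by have := t.2.2; rw [h1] at this; linarith
    have hd : y.1 = x.1 := by simpa using congrArg Prod.fst h2
    have hfd : (D.monodromy x).1 = x.1 := rfl
    rw [h1, hd, D.κ_add_one x.1 s hs0 hs] at h2
    rw [← hfd, ← fishTurn_fishMonodromy D.ha' D.hab' D.hb'] at h2
    exact fishTurn_injective hg1 _ _ h2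
  · have hs0 : 0 ≤ (s : ℝ) := s.2.1.le
    have hs : (s : ℝ) ≤ 1 / 2 := by have := t.2.2; rw [h1] at this; linarith
    have hfd : (D.monodromy x).1 = x.1 := rfl
    rw [h1, h2, hfd, D.κ_add_one x.1 s hs0 hs]
    exact fishTurn_fishMonodromy D.ha' D.hab' D.hb' _ _ x

/-- **`MTorus Ψ` is an open gluing of the two cylinders along its own relation with the twisted
witnesses** `inl ∘ twistOne`, `inr ∘ twistTwo`. [cite: GompfAGT2010, Lemma 2.2 (proof)] -/
theorem isOpenGluingWith_mTorus_twist :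
    IsOpenGluingWith (ModelWithCorners.prod 𝓣 𝓘(ℝ, ℝ)) (ModelWithCorners.prod 𝓣 𝓘(ℝ, ℝ)) (𝓡 4)
      (mappingTorusRel ⇑D.monodromy)
      ((mtGlueData D.monodromy).inl ∘ D.twistOne) ((mtGlueData D.monodromy).inr ∘ D.twistTwo) := by
  obtain ⟨hA, hAo, hB, hBo, hU, hR⟩ := isOpenGluingWith_mappingTorusGlued D.monodromy linTorusModel
  have hsA : Function.Surjective D.twistOne := D.twistOne.surjective
  have hsB : Function.Surjective D.twistTwo := D.twistTwo.surjective
  refine ⟨hA.comp_diffeomorph _, ?_, hB.comp_diffeomorph _, ?_, ?_, fun p q ↦ ?_⟩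
  · rwa [hsA.range_comp]
  · rwa [hsB.range_comp]
  · rwa [hsA.range_comp, hsB.range_comp]
  · rw [Function.comp_apply, Function.comp_apply, hR]
    exact D.mappingTorusRel_twist_iff p q

/-- **Gompf's diffeomorphism of the model end exists** (uniqueness of open gluings with
witnesses). [cite: GompfAGT2010, Lemma 2.2 (proof: the diffeomorphism extends over Φ)] -/
theorem exists_baseTurn :
    ∃ R : MTorus D.monodromy ≃ₘ⟮𝓡 4, 𝓡 4⟯ MTorus D.monodromy,
      (∀ p, R ((mtGlueData D.monodromy).inl (D.twistOne p)) = (mtGlueData D.monodromy).inl p) ∧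
      (∀ q, R ((mtGlueData D.monodromy).inr (D.twistTwo q)) = (mtGlueData D.monodromy).inr q) :=
  D.isOpenGluingWith_mTorus_twist.exists_diffeomorph_apply_eq
    (isOpenGluingWith_mappingTorusGlued D.monodromy linTorusModel)

/-- **Gompf's diffeomorphism of the model end** (the base turn) for a depth-dependent staircase:
on both cylinders `[x, s] ↦ [F_{κ(x₁, s), u(x₁)} x, s]`. [cite: GompfAGT2010, Lemma 2.2 (proof: (s,t,x) ↦ (s,s+t,x) is the required diffeomorphism for s = 1 and the identity for s = 0)] -/
def baseTurn : MTorus D.monodromy ≃ₘ⟮𝓡 4, 𝓡 4⟯ MTorus D.monodromy :=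
  D.exists_baseTurn.choose.symm

/-- **The base turn on the first cylinder**: `R [x, s] = [F_{κ(x₁,s), u(x₁)} x, s]`. [folklore] -/
theorem baseTurn_inl (p : ThreeTorus × ↥mappingTorusPieceOne) :
    D.baseTurn ((mtGlueData D.monodromy).inl p) = (mtGlueData D.monodromy).inl (D.twistOne p) := by
  have h := D.exists_baseTurn.choose_spec.1 p
  rw [baseTurn, ← h, Diffeomorph.symm_apply_apply]

/-- **The base turn on the second cylinder**: `R [y, t] = [F_{κ(y₁,t), u(y₁)} y, t]`. [folklore] -/
theorem baseTurn_inr (q : ThreeTorus × ↥mappingTorusPieceTwo) :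
    D.baseTurn ((mtGlueData D.monodromy).inr q) = (mtGlueData D.monodromy).inr (D.twistTwo q) := by
  have h := D.exists_baseTurn.choose_spec.2 q
  rw [baseTurn, ← h, Diffeomorph.symm_apply_apply]

/-- **Where the turn profile vanishes the base turn is the identity** (deep inside `Φ`). [cite: GompfAGT2010, Lemma 2.2 (proof: the identity for s = 0)] -/
theorem baseTurn_inl_of_eq_zero {x : ThreeTorus} (hx : D.u x.1 = 0) (s : ↥mappingTorusPieceOne) :
    D.baseTurn ((mtGlueData D.monodromy).inl (x, s)) = (mtGlueData D.monodromy).inl (x, s) := by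
  rw [baseTurn_inl, twistOne_apply]
  show (mtGlueData D.monodromy).inl (fishTurn D.lift (D.κ x.1 s) (D.u x.1) x, s) = _
  rw [hx, fishTurn_zero D.lift_add_two_pi]

/-- Where the turn profile vanishes the base turn is the identity (second cylinder). [folklore] -/
theorem baseTurn_inr_of_eq_zero {y : ThreeTorus} (hy : D.u y.1 = 0) (t : ↥mappingTorusPieceTwo) :
    D.baseTurn ((mtGlueData D.monodromy).inr (y, t)) = (mtGlueData D.monodromy).inr (y, t) := by
  rw [baseTurn_inr, twistTwo_apply]
  show (mtGlueData D.monodromy).inr (fishTurn D.lift (D.κ y.1 t) (D.u y.1) y, t) = _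
  rw [hy, fishTurn_zero D.lift_add_two_pi]

/-- **Where the turn profile is `2π` the base turn is the sliver twist**
`[(z₁, z₂, z₃), s] ↦ [(z₁, z₂, z₃ e^{2πiκ(z₁, s)}), s]`. [cite: GompfAGT2010, Lemma 2.2 (proof: ψ on each fiber for s = 1) and Thm 2.1 (proof: cut along the front face and reglue by the Dehn twist)] -/
theorem baseTurn_inl_of_eq_two_pi {x : ThreeTorus} (hx : D.u x.1 = 2 * π) (s : ↥mappingTorusPieceOne) :
    D.baseTurn ((mtGlueData D.monodromy).inl (x, s)) =
      (mtGlueData D.monodromy).inl ((x.1, x.2.1, x.2.2 * Circle.exp (2 * π * D.κ x.1 s)), s) := by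
  rw [baseTurn_inl, twistOne_apply]
  show (mtGlueData D.monodromy).inl (fishTurn D.lift (D.κ x.1 s) (D.u x.1) x, s) = _
  rw [hx, fishTurn_two_pi D.lift_add_two_pi]

/-- Where the turn profile is `2π` the base turn is the sliver twist (second cylinder). [folklore] -/
theorem baseTurn_inr_of_eq_two_pi {y : ThreeTorus} (hy : D.u y.1 = 2 * π) (t : ↥mappingTorusPieceTwo) :
    D.baseTurn ((mtGlueData D.monodromy).inr (y, t)) =
      (mtGlueData D.monodromy).inr ((y.1, y.2.1, y.2.2 * Circle.exp (2 * π * D.κ y.1 t)), t) := by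
  rw [baseTurn_inr, twistTwo_apply]
  show (mtGlueData D.monodromy).inr (fishTurn D.lift (D.κ y.1 t) (D.u y.1) y, t) = _
  rw [hy, fishTurn_two_pi D.lift_add_two_pi]

/-- **Where the turn profile is `2π` and the staircase takes an integer value the base turn is the
identity** (off the band a full rotation of the `γ`-circle is trivial). [folklore] -/
theorem baseTurn_inr_of_eq_two_pi_of_int {y : ThreeTorus} (hy : D.u y.1 = 2 * π)
    (t : ↥mappingTorusPieceTwo) {k : ℤ} (hk : D.κ y.1 t = k) :
    D.baseTurn ((mtGlueData D.monodromy).inr (y, t)) = (mtGlueData D.monodromy).inr (y, t) := by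
  rw [D.baseTurn_inr_of_eq_two_pi hy, hk, Circle.exp_two_pi_mul_int, mul_one]

/-- The same on the first cylinder. [folklore] -/
theorem baseTurn_inl_of_eq_two_pi_of_int {x : ThreeTorus} (hx : D.u x.1 = 2 * π)
    (s : ↥mappingTorusPieceOne) {k : ℤ} (hk : D.κ x.1 s = k) :
    D.baseTurn ((mtGlueData D.monodromy).inl (x, s)) = (mtGlueData D.monodromy).inl (x, s) := by
  rw [D.baseTurn_inl_of_eq_two_pi hx, hk, Circle.exp_two_pi_mul_int, mul_one]

/-- **The base turn preserves the depth coordinate** (first cylinder). [folklore] -/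
theorem baseTurn_inl_fst (p : ThreeTorus × ↥mappingTorusPieceOne) :
    ∃ x' : ThreeTorus, x'.1 = p.1.1 ∧
      D.baseTurn ((mtGlueData D.monodromy).inl p) = (mtGlueData D.monodromy).inl (x', p.2) :=
  ⟨fishTurn D.lift (D.κ p.1.1 p.2) (D.u p.1.1) p.1, rfl, by rw [baseTurn_inl, twistOne_apply]⟩

/-- The base turn preserves the depth coordinate (second cylinder). [folklore] -/
theorem baseTurn_inr_fst (q : ThreeTorus × ↥mappingTorusPieceTwo) :
    ∃ y' : ThreeTorus, y'.1 = q.1.1 ∧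
      D.baseTurn ((mtGlueData D.monodromy).inr q) = (mtGlueData D.monodromy).inr (y', q.2) :=
  ⟨fishTurn D.lift (D.κ q.1.1 q.2) (D.u q.1.1) q.1, rfl, by rw [baseTurn_inr, twistTwo_apply]⟩

end FishParamsD

end Literature.Topology.FourManifolds
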